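import Summits.QuantumFields.BalabanUV.T4Continuum.Spine.NE1p.DressedStabilityStrictOfCanonicalSliceWinSchedules
import Summits.QuantumFields.BalabanUV.T4Continuum.Spine.NE1p.DressedTerminalWitnessReuseEnd

/-!
# T⁴ programme, spine estimate NE1′ (node O3b/H2) — THE ROOT OF RECORD `DressedStabilityStrict` AT THE CANONICAL TERMINAL FACE, part 2
# of 2 (WITNESS): the crew's function-level decided toys meet the STRICT root BY NAME — W7's tower through END-B at the cell constant,
# W11r's integer firing of the canonical terminal face through part 1's bridge, the decided `L = 100`, and the separation from the
# owner's doubling tower (swarm item S3s of `t4/formal/NE1p/LEAVES.md` v2.6.9, node N23s; typer R-T65 (vii); CLAIM CLAIMS.log l.12331)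

Cell `pub-balaban`, sub-cell `t4`, BINDER-OWNERS row NE1′, formalisation crew `b2b-balaban-t4-ne1p-formalise-*`, seat `…-leaf-08`
(gen 2).  ADDITIVE — imports part 1 `Spine/NE1p/DressedStabilityStrictOfCanonicalSliceWinSchedules` (the bridge
`dressedStabilityStrict_of_cellWith`; through it the OWNER's `Spine/NE1p/DressedRootStrict` p216910 — ROOT-C OF RECORD
`DressedRoot.DressedStabilityStrict`, `dressedStabilityStrict_of_bookingLeaves`, the doubling tower `growingTower` with
`not_dressedStabilityStrict_growingTower`) and leaf-02's row W11r part 2 `Spine/NE1p/DressedTerminalWitnessReuseEnd` (p216317 ACCEPTED: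
`dressedStabilityWith_towerM_integer`; through its chain W11r part 1 p216180 — `one_le_natL`, `hloc_int`, `hρ'_int` — and leaf-03's
rows W5∕W7 — `towerM`, the ONE `UW : UniformConstants`, the per-cutoff bundles `leavesM`, `LW`) ONLY; modifies nothing (no append to any
witness file; the strict statements are NEW, so the gate's `dedup.landed` is not engaged).

WHY.  ROOT-C OF RECORD is now `DressedStabilityStrict 𝒯 Λ` (owner, CLAIMS.log l.12196 (B)); the referee's (t5) non-vacuity column
for the root therefore asks for decided toys meeting the STRICT root, not only the headline `DressedStability`.  No re-instantiation is
needed: every toy already carries the product datum — W7's `towerM` through the ONE `UW` (`UW.hprod`: `LW⁴·rhoOne LW⁻² 2 0 ½·LW⁻³ =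
locCell LW 2 0 ½ = ½ ≤ ρ′ = ½ < 1`), W11r's integer firing through `hloc_int` (`3e³∕Lb ≤ ¾ < 1`).
* `dressedStabilityStrict_towerM : DressedStabilityStrict towerM UW.Λ` — END-B in the strict form on `leavesM`, `UW.Λ = LW⁴` (`UW_Λ`);
* `dressedStabilityStrict_towerM_integer (h81) (h120) : DressedStabilityStrict towerM ((Lb:ℝ)^4)` — THE CANONICAL TERMINAL FACE FIRED
  AT AN INTEGER `81 ≤ Lb ≤ 120` (W11r) through part 1's bridge; `dressedStabilityStrict_towerM_hundred` (decided `Lb = 100`);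
* `strictRoot_separates` — the strict root ACCEPTS W7's tower and REJECTS the owner's doubling tower (G-wardbootg6-1's point, by name).

WHAT IT IS NOT.  Not an estimate; corollaries BY NAME on DECIDED TOYS (labelled toy) — [folklore] kernel bookkeeping, theorems only,
0 `def`, 0 `def … : Prop`, 0 sorry, 0 citations used as facts; nothing of Bałaban's densities or of [Balaban1989LargeFieldII] is
encoded or asserted (CONTEXT only).  `LW = 6e³` and the integers `81 ≤ Lb ≤ 120` are the toys' blocking factors, NOT Bałaban's `L`
(caveat k2).  It changes NOTHING about the walls: (w1)∕(w2-act) [THE NUMBER]∕(w5)∕(I4′)-rate stay DISPLAYED binders of the terminal face.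

HONEST FRAMING.  Headline (c4): «the decided toys meet the ROOT OF RECORD `DressedStabilityStrict` — W7's tower at Λ = LW⁴, the
canonical terminal face fired at every integer 81 ≤ L ≤ 120 at Λ = L⁴; non-vacuity of SHAPES, nothing of Bałaban's densities; NE1′ ⇐
the named binders, NOT proved, NOT printed»; spine PROVED 0∕9.  Rung (B)+1 on ONE finite four-torus of fixed physical size — NOT
infinite volume, NOT a mass gap, NOT OS on ℝ⁴, NOT the Clay problem.  HONEST DEPENDENCY: continuum YM on T⁴ ⇐ BetaPertH ∧ nine spine
estimates (0/9 proved); BetaPertH ⇐ (D1) ∧ (D4) ∧ CAP+tail; G-an2-4 gates asym, D1 and NE2/3/4.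
-/

noncomputable section

namespace Summit.QuantumFields.BalabanUV.T4Continuum.NE1p.DressedTerminalWitnessStrict

open Literature.MathematicalPhysics.QuantumFieldTheory.Balaban1983to89
open Literature.MathematicalPhysics.QuantumFieldTheory.Balaban1983to89.T4TermFormat
open Literature.MathematicalPhysics.QuantumFieldTheory.Balaban1983to89.T4TrajectoryComparison
open Summit.QuantumFields.BalabanUV.T4Continuum.T4TrajectoryDensityDressed
open Summit.QuantumFields.BalabanUV.T4Continuum.NE1p.DressedRoot
open Summit.QuantumFields.BalabanUV.T4Continuum.NE1p.DressedUniformConstants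
open Summit.QuantumFields.BalabanUV.T4Continuum.NE1p.DressedTowerWitness
open Summit.QuantumFields.BalabanUV.T4Continuum.NE1p.DressedTowerWitnessSlice
open Summit.QuantumFields.BalabanUV.T4Continuum.NE1p.DressedTerminalWitnessReuse
open Summit.QuantumFields.BalabanUV.T4Continuum.NE1p.DressedTerminalWitnessReuseEnd
open Summit.QuantumFields.BalabanUV.T4Continuum.NE1p.DressedStabilityStrictOfCanonicalSliceWinSchedules

/-! ## §3 The function-level witnesses meet the STRICT root [decided toys, by name] -/

/-- **W7's TOWER MEETS THE ROOT OF RECORD AT THE CELL CONSTANT** [decided toy]: `DressedStabilityStrict towerM UW.Λ` — END-B in the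
strict form (`dressedStabilityStrict_of_bookingLeaves`) on leaf-03's ONE `UW` and per-cutoff bundles `leavesM`; `UW.Λ = LW⁴`, the
product `LW⁴·rhoOne LW⁻² 2 0 ½·LW⁻³ = locCell LW 2 0 ½ = ½ < 1`.  Strict twin of W7's `dressedStability_towerM`. [folklore] -/
theorem dressedStabilityStrict_towerM : DressedStabilityStrict towerM UW.Λ :=
  dressedStabilityStrict_of_bookingLeaves UW towerM fun _ K => leavesM K

/-- `UW.Λ` is the cell constant's positional count `LW⁴`. [folklore] -/
theorem UW_Λ : UW.Λ = LW ^ 4 := rfl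

section Fires

variable (Lb : ℕ) (h81 : 81 ≤ Lb) (h120 : Lb ≤ 120)
include h81 h120

/-- **THE CANONICAL TERMINAL FACE, FIRED AT AN INTEGER BLOCKING FACTOR, MEETS THE ROOT OF RECORD** [decided toy]: for every
`81 ≤ Lb ≤ 120`, `DressedStabilityStrict towerM ((Lb:ℝ)^4)` — leaf-02's W11r `dressedStabilityWith_towerM_integer` (constants
`(1, rhoOne Lb⁻² 2 0 ½, Lb⁻³)` displayed) through part 1's bridge `dressedStabilityStrict_of_cellWith` with W11r's located largeness `hloc_int : locCell Lb 2 0 ½ = 3e³∕Lb ≤ ¾` and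
`¾ < 1`: the strict product is `3e³∕Lb ≤ ¾`. [folklore] -/
theorem dressedStabilityStrict_towerM_integer : DressedStabilityStrict towerM (((Lb : ℝ)) ^ 4) :=
  dressedStabilityStrict_of_cellWith (one_le_natL h81) (hloc_int h81) hρ'_int
    (dressedStabilityWith_towerM_integer Lb h81 h120)

end Fires

/-- **DECIDED: THE ROOT OF RECORD AT `L = 100`** — `DressedStabilityStrict towerM 100⁴` (strict product `3e³∕100 < 0.61 ≤ ¾ < 1`).
[folklore] -/
theorem dressedStabilityStrict_towerM_hundred : DressedStabilityStrict towerM ((((100 : ℕ) : ℝ)) ^ 4) :=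
  dressedStabilityStrict_towerM_integer 100 (by norm_num) (by norm_num)

/-- The owner's doubling tower is REJECTED by the root of record while W7's tower is ACCEPTED — the strict product separates them
in kernel (`not_dressedStabilityStrict_growingTower` ∕ `dressedStabilityStrict_towerM`). [folklore] -/
theorem strictRoot_separates :
    DressedStabilityStrict towerM UW.Λ ∧ ¬ DressedStabilityStrict growingTower 1 :=
  ⟨dressedStabilityStrict_towerM, not_dressedStabilityStrict_growingTower⟩

end Summit.QuantumFields.BalabanUV.T4Continuum.NE1p.DressedTerminalWitnessStrict

end
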